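import Literature.NumberTheory.GaloisRepresentations.WeakAbelianDirectSummand
import Literature.NumberTheory.GaloisRepresentations.ArtinCharacterReciprocityProofs
import Literature.NumberTheory.GaloisRepresentations.ArtinReciprocityCharacterProofs
import Literature.NumberTheory.GaloisRepresentations.ArtinRestriction
import Literature.NumberTheory.GaloisRepresentations.HeckeLFunctionAnalyticProofs
import Literature.NumberTheory.GaloisRepresentations.HeckeCharacterWeakApproximation
import Literature.NumberTheory.GaloisRepresentations.IntegralGaloisActionProofs
import HarnessLib

/-!
# Weak abelian direct summands (Böckle–Hui 2025, Thm. 1.1): the finite-image case, proved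

Topic `NumberTheory/GaloisRepresentations`; namespace
`Literature.NumberTheory.GaloisRepresentations`.  A *proofs* file (theorems only; no definition,
no named fact), sibling of `WeakAbelianDirectSummand.lean`, which vendors Böckle–Hui, *Weak
abelian direct summands and irreducibility of Galois representations*, Math. Ann. 393 (2025),
Thm. 1.1, in the Hecke-character form of BH §3.2.1 as the named fact
`exists_heckeCharacter_of_weaklyDivides`:

> for a character `ψ : Γ_K → GL_1(ℚ̄_ℓ)` weakly dividing a semisimple `E`-rational
> `ρ : Γ_K → GL_n(ℚ̄_ℓ)` and every `ι : ℚ̄_ℓ ≃ ℂ` there is an algebraic Hecke character `χ` of `K`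
> with `χ`, `ψ` unramified and `ψ(Frob_v) = ι⁻¹(χ(ϖ_v))⁻¹` at all but finitely many `v`.

## What is proved here

The conclusion of the fact for every `ℓ`-adic character `ψ` **with open kernel** (equivalently,
by compactness of `Γ_K`, with finite image), unconditionally and without reference to `ρ`:

* `HeckeCharacter.IsFiniteOrder.isAlgebraic` — a Hecke character of finite order is algebraic
  (type `A₀` with trivial infinity type: it is `1` on a neighbourhood of `1` in `(K ⊗ ℝ)ˣ`).
* `FramedGaloisRep.exists_heckeCharacter_of_isOpen_ker` — for `ψ : Γ_K →ₜ* GL_1(ℚ̄_ℓ)` with open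
  kernel and `ι : ℚ̄_ℓ ≃+* ℂ` there is a Hecke character `χ` of finite order (hence algebraic) such
  that at EVERY place `v` at which `ψ` is unramified, `χ` is unramified and
  `ψ.HasFrobCharpolyAt v (X - C (ι⁻¹(χ(ϖ_v))⁻¹))`.  Proof: `ι ∘ ψ : Γ_K → GL_1(ℂ)` has open kernel,
  hence is continuous for the complex topology, i.e. a rank-one Artin representation; the tree's
  PROVED Artin reciprocity law for linear characters
  (`artinReciprocity_character_holds`, `ArtinCharacterReciprocityProofs.lean`: Tate,
  Cassels–Fröhlich Ch. VII §5.1 (A) with §4.2) gives a finite-order `ω` with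
  `ω(ϖ_v) = ι(ψ(Frob_v))`; take `χ = ω⁻¹`.
* `FramedGaloisRep.exists_heckeCharacter_eventually_of_isOpen_ker` — the same at all but finitely
  many `v` (an open-kernel representation is unramified almost everywhere,
  `FramedGaloisRep.eventually_isUnramifiedAt_of_isOpen_ker`), i.e. literally the conclusion of
  `exists_heckeCharacter_of_weaklyDivides` for such `ψ`;
  `FramedGaloisRep.exists_heckeCharacter_eventually_of_finite_range` — the finite-image form.

* `HeckeCharacter.eq_of_hasFrobCharpolyAt_eventually`,
  `existsUnique_heckeCharacter_of_weaklyDivides` (appended) — **rigidity**: the Hecke character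
  `χ` in the conclusion of the fact is UNIQUE given `ψ` and `ι` (Frobenius elements exist,
  `HeightOneSpectrum.exists_isArithFrobAt_of_mem_primesAbove_holds`, and a Hecke character is
  determined by almost all `χ(ϖ_v)`, `HeckeCharacter.ext_of_eventually_valueAtUniformizer_eq`,
  Cassels–Fröhlich VII Prop. 4.1); granting the fact, its `∃ χ` is an `∃! χ`.

In Böckle–Hui's setting these are the weak abelian direct summands of finite order, which do
occur (BH Remark 2.5: "the trivial `1`-dimensional representation is a weak direct summand of any
`3`-dimensional `ℓ`-adic representation with image in `SO_3`"; any `χ_i` of a biquadratic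
`Gal(L/K)` weakly divides the sum of the other three), and in Serre's description of locally
algebraic characters (`ψ = ψ_alg · ε`, `ε` of finite order, *Abelian ℓ-adic representations*,
Ch. III §§2.3–3) this is the step handling the finite-order factor `ε`.

## What is NOT here (status of `exists_heckeCharacter_of_weaklyDivides`)

The general case is Böckle–Hui's Theorem 1.1 proper — `ψ` weakly dividing a semisimple
`E`-rational `ρ` is *locally algebraic* — followed by Serre's correspondence between locally
algebraic abelian `ℓ`-adic representations and algebraic Hecke characters.  Its printed proof
(BH §2.4–2.7) rests on three theories absent from Mathlib and from `Literature/`: Waldschmidt's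
`ℓ`-adic transcendence theorem in Henniart's form (BH Thm. 2.2; the tree vendors only Part I, "le
cas complexe", of Waldschmidt 1981, `Transcendental/SixExponentialsSeveralVariables.lean`), the
structure theory of the algebraic monodromy group of `ρ` (BH Lemmas 2.6–2.8, Prop. 2.9–2.11:
reductive groups, formal characters, Steinberg's density of regular semisimple elements, the
algebraic Chebotarev theorem of Serre–Rajan), and Serre's theory of the groups `S_𝔪`
(BH Prop. 2.12; Serre 1968 Ch. II–III, including the reciprocity map at the places above `ℓ`).
See the seat notes of `provefact-…exists_heckeCharacter_of_weaklyDivides`.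

## References

* G. Böckle, C.-Y. Hui, Math. Ann. 393 (2025), Thm. 1.1, Rem. 2.5, §3.2.1. [BockleHui2025]
* J. Tate, *Global class field theory*, Ch. VII of Cassels–Fröhlich (1967), §5.1 Main Theorem (A),
  §4.2 Corollary, §2.1. [CasselsFrohlichANT1967]
* J.-P. Serre, *Abelian ℓ-adic representations and elliptic curves* (1968), Ch. III §§2.3–3.
  [SerreAbelianLadic1968]
* J. Neukirch, *Algebraic Number Theory* (1999), VII (6.9) (characters of finite order).
  [NeukirchANT1999]
-/

noncomputable section

open scoped NumberField Matrix
open NumberField Field IsDedekindDomain Polynomial Filter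

namespace Literature.NumberTheory.GaloisRepresentations

universe u

/-! ### Finite-order Hecke characters are algebraic -/

namespace HeckeCharacter

variable {K : Type u} [Field K] [NumberField K]

/-- The embedding of the infinite ideles `(K ⊗ ℝ)ˣ ↪ 𝕀_K`, `x ↦ (x, 1)`, is continuous.
[folklore] -/
theorem continuous_infiniteIdeles : Continuous (infiniteIdeles K) := by
  refine Continuous.units_map (MonoidHom.inl (InfiniteAdeleRing K) (FiniteAdeleRing (𝓞 K) K)) ?_
  exact continuous_id.prodMk continuous_const

/-- **A Hecke character of finite order is algebraic** (of type `A₀` with trivial infinity type,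
`p_w = q_w = 0`): if `χⁿ = 1` then `x ↦ χ(x, 1)` is a continuous map on `(K ⊗ ℝ)ˣ` with values in
the `n`-th roots of unity, hence equal to `1` on the open neighbourhood of `1` where it avoids the
finitely many roots of unity `≠ 1`.
Ref: Neukirch, *Algebraic Number Theory*, VII (6.9) (characters of finite order are the characters
of ray class groups, of trivial infinity type); Weil (1956), type `A₀`. [folklore] -/
theorem IsFiniteOrder.isAlgebraic {χ : HeckeCharacter K} (hχ : χ.IsFiniteOrder) :
    χ.IsAlgebraic := by
  obtain ⟨n, hn, h1⟩ := hχ.exists_pow_eq_one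
  set f : (InfiniteAdeleRing K)ˣ → ℂ := fun x => (χ (infiniteIdeles K x) : ℂ) with hf
  have hcont : Continuous f :=
    Units.continuous_val.comp ((map_continuous χ).comp continuous_infiniteIdeles)
  -- the values of `f` are `n`-th roots of unity
  have hpow : ∀ x, f x ^ n = 1 := fun x => by
    have h := congrArg (fun φ : HeckeCharacter K => ((φ (infiniteIdeles K x) : ℂˣ) : ℂ)) h1
    simpa [pow_apply, Units.val_pow_eq_pow_val] using h
  -- the nontrivial `n`-th roots of unity form a finite, hence closed, set
  set S : Set ℂ := {z | z ^ n = 1 ∧ z ≠ 1} with hS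
  have hSfin : S.Finite := by
    refine (Multiset.finite_toSet (Polynomial.nthRoots n (1 : ℂ))).subset fun z hz => ?_
    simp only [Set.mem_setOf_eq] at hz ⊢
    exact (Polynomial.mem_nthRoots hn).mpr hz.1
  have hopen : IsOpen (f ⁻¹' Sᶜ) := hSfin.isClosed.isOpen_compl.preimage hcont
  have hone : (1 : (InfiniteAdeleRing K)ˣ) ∈ f ⁻¹' Sᶜ := by
    simp [hf, hS]
  refine ⟨0, 0, f ⁻¹' Sᶜ, hopen.mem_nhds hone, fun x hx => ?_⟩
  have hx' : f x ∉ S := hx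
  have hfx : f x = 1 := by
    by_contra hne
    exact hx' ⟨hpow x, hne⟩
  simp only [Pi.zero_apply, neg_zero, zpow_zero, mul_one, Finset.prod_const_one]
  exact hfx

end HeckeCharacter

/-! ### `ℓ`-adic characters with open kernel come from Hecke characters of finite order -/

namespace FramedGaloisRep

variable {K : Type} [Field K] [NumberField K] {ℓ : ℕ} [Fact ℓ.Prime]

/-- A homomorphism of topological groups with open kernel is continuous (it is locally constant).
(Same statement as `MonoidHom.continuous_of_isOpen_ker` of `GlobalArtinMapOfCharactersProofs`,
kept private here.) [folklore] -/
private theorem continuous_of_isOpen_ker_aux {Γ M : Type*} [Group Γ] [TopologicalSpace Γ]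
    [IsTopologicalGroup Γ] [Group M] [TopologicalSpace M] [IsTopologicalGroup M] (f : Γ →* M)
    (hf : IsOpen (f.ker : Set Γ)) : Continuous f := by
  refine continuous_of_continuousAt_one f ?_
  rw [ContinuousAt, map_one]
  refine Filter.tendsto_def.mpr fun W hW => Filter.mem_of_superset (hf.mem_nhds f.ker.one_mem) ?_
  intro x hx
  rw [Set.mem_preimage, (MonoidHom.mem_ker).mp hx]
  exact mem_of_mem_nhds hW

/-- **An `ℓ`-adic character with open kernel comes from a Hecke character of finite order**
(Artin reciprocity transported along `ι : ℚ̄_ℓ ≃ ℂ`).  Let `ψ : Γ_K →ₜ* GL_1(ℚ̄_ℓ)` have open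
kernel and let `ι : ℚ̄_ℓ ≃+* ℂ`.  Then `ι ∘ ψ : Γ_K → GL_1(ℂ)` has open kernel, hence is a
(continuous) rank-one Artin representation, and Artin's reciprocity law for linear characters
(Tate, Cassels–Fröhlich Ch. VII §5.1 Main Theorem (A) with §4.2 Corollary and §2.1; the tree's
proved `artinReciprocity_character_holds`) supplies a finite-order Hecke character `ω` with
`ω(ϖ_v) = ι(ψ(Frob_v))` at every place `v` at which `ψ` is unramified.  With `χ = ω⁻¹` (finite
order, hence algebraic by `HeckeCharacter.IsFiniteOrder.isAlgebraic`; unramified where `ω` is,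
`HeckeCharacter.isUnramifiedAt_inv_iff`, with `χ(ϖ_v) = ω(ϖ_v)⁻¹`,
`HeckeCharacter.valueAtUniformizer_inv`): at every such `v`, `χ` is unramified and
`ψ(Φ) = ι⁻¹(χ(ϖ_v))⁻¹` for every arithmetic Frobenius `Φ` above `v`, i.e.
`ψ.HasFrobCharpolyAt v (X - C (ι⁻¹(χ(ϖ_v))⁻¹))` — the conclusion of Böckle–Hui's Theorem 1.1 in
the form of `exists_heckeCharacter_of_weaklyDivides`, for `ψ` of finite image.
[cite: CasselsFrohlichANT1967, Ch. VII §5.1 Main Theorem (A), §4.2 Corollary, §2.1] -/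
theorem exists_heckeCharacter_of_isOpen_ker (ψ : FramedGaloisRep K (PadicAlgCl ℓ) 1)
    (hker : IsOpen (ψ.toMonoidHom.ker : Set (absoluteGaloisGroup K))) (ι : PadicAlgCl ℓ ≃+* ℂ) :
    ∃ χ : HeckeCharacter K, χ.IsAlgebraic ∧ χ.IsFiniteOrder ∧
      ∀ v : HeightOneSpectrum (𝓞 K), ψ.IsUnramifiedAt v →
        χ.IsUnramifiedAt v ∧ ψ.HasFrobCharpolyAt v (X - C (ι.symm (χ.valueAtUniformizer v)⁻¹)) := by
  -- the transported character `ι ∘ ψ : Γ_K → GL_1(ℂ)`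
  set f : GL (Fin 1) (PadicAlgCl ℓ) →* GL (Fin 1) ℂ :=
    Matrix.GeneralLinearGroup.map (ι : PadicAlgCl ℓ →+* ℂ) with hfdef
  have hkerle : ψ.toMonoidHom.ker ≤ (f.comp ψ.toMonoidHom).ker := fun σ hσ => by
    rw [MonoidHom.mem_ker] at hσ ⊢
    rw [MonoidHom.comp_apply, hσ, map_one]
  let χA : FramedArtinRep K 1 :=
    ⟨f.comp ψ.toMonoidHom, continuous_of_isOpen_ker_aux _ (Subgroup.isOpen_mono hkerle hker)⟩
  have hχA : ∀ σ : absoluteGaloisGroup K, χA σ = f (ψ σ) := fun σ => rfl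
  have hentry : ∀ σ : absoluteGaloisGroup K,
      ((χA σ : GL (Fin 1) ℂ) : Matrix (Fin 1) (Fin 1) ℂ) 0 0 =
        ι (((ψ σ : GL (Fin 1) (PadicAlgCl ℓ)) : Matrix (Fin 1) (Fin 1) (PadicAlgCl ℓ)) 0 0) :=
    fun σ => by
      rw [hχA, hfdef]
      exact Matrix.GeneralLinearGroup.map_apply _ _ _ _
  -- `χA` is unramified wherever `ψ` is
  have hunr : ∀ v, ψ.IsUnramifiedAt v → χA.IsUnramifiedAt v := fun v hv 𝔓 h𝔓 σ hσ => by
    rw [hχA, hv 𝔓 h𝔓 σ hσ, map_one]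
  -- Artin reciprocity for the linear character `χA`
  obtain ⟨ω, hfin, hω⟩ := artinReciprocity_character_holds K χA
  have hfin' : (ω⁻¹).IsFiniteOrder := hfin.inv
  refine ⟨ω⁻¹, hfin'.isAlgebraic, hfin', fun v hv =>
    ⟨HeckeCharacter.isUnramifiedAt_inv_iff.mpr (hω v (hunr v hv)).1, ?_⟩⟩
  have hfrob := (FramedGaloisRep.hasFrobCharpolyAt_iff_of_rank_one χA v _).mp (hω v (hunr v hv)).2
  refine (FramedGaloisRep.hasFrobCharpolyAt_iff_of_rank_one ψ v _).mpr fun 𝔓 h𝔓 Φ hΦ => ?_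
  rw [HeckeCharacter.valueAtUniformizer_inv, inv_inv, ← hfrob 𝔓 h𝔓 Φ hΦ, hentry,
    RingEquiv.symm_apply_apply]

/-- **Cofinite form**: for `ψ : Γ_K →ₜ* GL_1(ℚ̄_ℓ)` with open kernel and `ι : ℚ̄_ℓ ≃+* ℂ` there is a
finite-order (hence algebraic) Hecke character `χ` such that at all but finitely many `v`, `χ`
and `ψ` are unramified and `ψ.HasFrobCharpolyAt v (X - C (ι⁻¹(χ(ϖ_v))⁻¹))` — the conclusion of
`exists_heckeCharacter_of_weaklyDivides` for `ψ` (`exists_heckeCharacter_of_isOpen_ker` with the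
almost-everywhere unramifiedness of an open-kernel representation,
`FramedGaloisRep.eventually_isUnramifiedAt_of_isOpen_ker`).
[cite: CasselsFrohlichANT1967, Ch. VII §5.1 Main Theorem (A), §4.2 Corollary, §2.1] -/
theorem exists_heckeCharacter_eventually_of_isOpen_ker (ψ : FramedGaloisRep K (PadicAlgCl ℓ) 1)
    (hker : IsOpen (ψ.toMonoidHom.ker : Set (absoluteGaloisGroup K))) (ι : PadicAlgCl ℓ ≃+* ℂ) :
    ∃ χ : HeckeCharacter K, χ.IsAlgebraic ∧ χ.IsFiniteOrder ∧
      ∀ᶠ v : HeightOneSpectrum (𝓞 K) in cofinite, χ.IsUnramifiedAt v ∧ ψ.IsUnramifiedAt v ∧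
        ψ.HasFrobCharpolyAt v (X - C (ι.symm (χ.valueAtUniformizer v)⁻¹)) := by
  obtain ⟨χ, halg, hfin, hχ⟩ := ψ.exists_heckeCharacter_of_isOpen_ker hker ι
  exact ⟨χ, halg, hfin, (ψ.eventually_isUnramifiedAt_of_isOpen_ker hker).mono fun v hv =>
    ⟨(hχ v hv).1, hv, (hχ v hv).2⟩⟩

/-- **Finite-image form**: an `ℓ`-adic character `ψ : Γ_K →ₜ* GL_1(ℚ̄_ℓ)` with finite image has
open kernel (`isOpen_ker_of_finite_range`: the kernel is closed of finite index), so the conclusion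
of `exists_heckeCharacter_of_weaklyDivides` holds for it with a Hecke character of finite order —
in particular for every weak abelian direct summand of finite order (Böckle–Hui, Remark 2.5: the
trivial character weakly divides every `ρ` with image in `SO_3`).
[cite: BockleHui2025, Theorem 1.1 and Remark 2.5] -/
theorem exists_heckeCharacter_eventually_of_finite_range (ψ : FramedGaloisRep K (PadicAlgCl ℓ) 1)
    [Finite ψ.toMonoidHom.range] (ι : PadicAlgCl ℓ ≃+* ℂ) :
    ∃ χ : HeckeCharacter K, χ.IsAlgebraic ∧ χ.IsFiniteOrder ∧
      ∀ᶠ v : HeightOneSpectrum (𝓞 K) in cofinite, χ.IsUnramifiedAt v ∧ ψ.IsUnramifiedAt v ∧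
        ψ.HasFrobCharpolyAt v (X - C (ι.symm (χ.valueAtUniformizer v)⁻¹)) :=
  ψ.exists_heckeCharacter_eventually_of_isOpen_ker (isOpen_ker_of_finite_range ψ) ι

end FramedGaloisRep

/-! ### Rigidity: the Hecke character in the conclusion is unique -/

section Unique

variable {K : Type} [Field K] [NumberField K] {ℓ : ℕ} [Fact ℓ.Prime]

/-- **The algebraic Hecke character attached to `ψ` (and `ι`) is unique.**  If two Hecke
characters `χ₁, χ₂` both satisfy `ψ.HasFrobCharpolyAt v (X - C (ι⁻¹(χᵢ(ϖ_v))⁻¹))` at all but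
finitely many `v`, then `χ₁ = χ₂`: at almost every `v` pick a prime `𝔓 ∣ v` and an arithmetic
Frobenius `Φ` (`HeightOneSpectrum.exists_isArithFrobAt_of_mem_primesAbove_holds`); then
`ι⁻¹(χ₁(ϖ_v))⁻¹ = ψ(Φ)₀₀ = ι⁻¹(χ₂(ϖ_v))⁻¹`, so `χ₁(ϖ_v) = χ₂(ϖ_v)` for almost all `v`, and a Hecke
character is determined by almost all of its values at uniformizers
(`HeckeCharacter.ext_of_eventually_valueAtUniformizer_eq`).
Ref: Cassels–Fröhlich, Ch. VII §4, Prop. 4.1 (uniqueness); Serre (1968), Ch. II §2.3 ("the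
character `χ` is determined by `ψ`", Chebotarev/unicity).
[cite: CasselsFrohlichANT1967, Ch. VII §4 Prop. 4.1 (proof)] -/
theorem HeckeCharacter.eq_of_hasFrobCharpolyAt_eventually (ψ : FramedGaloisRep K (PadicAlgCl ℓ) 1)
    (ι : PadicAlgCl ℓ ≃+* ℂ) {χ₁ χ₂ : HeckeCharacter K}
    (h₁ : ∀ᶠ v : HeightOneSpectrum (𝓞 K) in cofinite,
      ψ.HasFrobCharpolyAt v (X - C (ι.symm (χ₁.valueAtUniformizer v)⁻¹)))
    (h₂ : ∀ᶠ v : HeightOneSpectrum (𝓞 K) in cofinite,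
      ψ.HasFrobCharpolyAt v (X - C (ι.symm (χ₂.valueAtUniformizer v)⁻¹))) : χ₁ = χ₂ := by
  refine HeckeCharacter.ext_of_eventually_valueAtUniformizer_eq ((h₁.and h₂).mono fun v hv => ?_)
  obtain ⟨𝔓, h𝔓⟩ := v.primesAbove_nonempty
  obtain ⟨Φ, hΦ⟩ := HeightOneSpectrum.exists_isArithFrobAt_of_mem_primesAbove_holds h𝔓
  have e₁ := (FramedGaloisRep.hasFrobCharpolyAt_iff_of_rank_one ψ v _).mp hv.1 𝔓 h𝔓 Φ hΦ
  have e₂ := (FramedGaloisRep.hasFrobCharpolyAt_iff_of_rank_one ψ v _).mp hv.2 𝔓 h𝔓 Φ hΦ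
  exact inv_injective (ι.symm.injective (e₁.symm.trans e₂))

/-- **Granting Böckle–Hui's Theorem 1.1, the algebraic Hecke character is unique**: under the
hypotheses of `exists_heckeCharacter_of_weaklyDivides` (hypothesis `h`), for every `ι` there is a
UNIQUE Hecke character `χ` which is algebraic and satisfies the Frobenius condition of the fact
at almost all places (`HeckeCharacter.eq_of_hasFrobCharpolyAt_eventually`).  So the named fact,
an `∃`, has the strength of an `∃!`. [cite: BockleHui2025, Theorem 1.1 and §3.2.1] -/
theorem existsUnique_heckeCharacter_of_weaklyDivides (h : exists_heckeCharacter_of_weaklyDivides)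
    {n : ℕ} {E : Type} [Field E] [NumberField E] (e : E →+* PadicAlgCl ℓ)
    {ρ : FramedGaloisRep K (PadicAlgCl ℓ) n} (hss : ρ.toGaloisRep.IsSemisimple)
    (hrat : ρ.IsRationalOver e) {ψ : FramedGaloisRep K (PadicAlgCl ℓ) 1} (hψ : ψ.WeaklyDivides ρ)
    (ι : PadicAlgCl ℓ ≃+* ℂ) :
    ∃! χ : HeckeCharacter K, χ.IsAlgebraic ∧
      ∀ᶠ v : HeightOneSpectrum (𝓞 K) in cofinite, χ.IsUnramifiedAt v ∧ ψ.IsUnramifiedAt v ∧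
        ψ.HasFrobCharpolyAt v (X - C (ι.symm (χ.valueAtUniformizer v)⁻¹)) := by
  obtain ⟨χ, hχ, hχ'⟩ := h K ℓ n E e ρ hss hrat ψ hψ ι
  refine ⟨χ, ⟨hχ, hχ'⟩, fun χ' hχ'' => ?_⟩
  exact HeckeCharacter.eq_of_hasFrobCharpolyAt_eventually ψ ι
    (hχ''.2.mono fun v hv => hv.2.2) (hχ'.mono fun v hv => hv.2.2)

end Unique

end Literature.NumberTheory.GaloisRepresentations
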